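import Summits.HodgeConjecture.HodgeConjecture.Theorems.Ring2WeilCoverageCyclotomicUnitSignatures
import Summits.HodgeConjecture.HodgeConjecture.Theorems.Ring2WeilCoverageRealUnitNormAllLevels
import HarnessLib

/-!
# Weil-type family coverage — THE `g = 4` CYCLOTOMIC LEVELS `15, 20, 24`: THEOREM L (ii) IS KERNEL (one unit
# `ζ^h(1 − ζ)(1 − ζ^b)` per pattern), and the eight census rows `(M, K)` of the octic cyclotomic CM fields
# `ℚ(ζ₁₅) ⊃ ℚ(√−15), ℚ(√−3)` · `ℚ(ζ₂₀) ⊃ ℚ(i), ℚ(√−5)` · `ℚ(ζ₂₄) ⊃ ℚ(i), ℚ(√−2), ℚ(√−3), ℚ(√−6)` are DECIDED,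
# hypothesis-free: NO, NO at `15`; YES ×6 at `20`, `24`

research route conditional on HC_CM; not a corollary; Q11.4-sentence-2 already refuted in dim ≥ 3.

Ring 2, WEIL-TYPE FAMILY-COVERAGE CENSUS (`HOME/WEIL-FAMILY-COVERAGE.md` `## b01`, block b01.46 «the cyclotomic CM
FOURFOLDS of Weil type»; owner ring2-b01 = the `g = 4` owner), part 75 of the `Ring2WeilCoverage*` series.  The
census's kernel verdicts (parts 7–74) covered every cyclotomic level `M` with `φ(M) ∈ {12, 16, 20, 24}`; the four
OCTIC levels `φ(M) = 8` — `M ∈ {15, 16, 20, 24}` (`30` gives the field of `15`), the CM fields of the CM abelian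
FOURFOLDS with cyclotomic multiplication — were left out («not run», b05.10 (F)(viii)).  This file does `15, 20, 24`
with the unit-product family of part 13 (`u(a,b,h) = ζ^h(1 − ζ^a)(1 − ζ^b)`, sign law
`negAt (a,b,h) t := (M < at mod 2M ↔ M < bt mod 2M)`); the prime-power level `16` (no unit `1 − ζ^a`) is part 76.
At `g = 4` the witness property `(W)` of part 14 is met by SINGLE units: for each unit residue `s ∉ {±1}` one
`u(1, b, h)` is negative exactly at the places `{±1, ±s}`.

* `witnessTable_M` (`decide +kernel`), `witnessProperty_M`: `(W)` at `M = 15, 20, 24`;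
* **`exists_units_sign_eq_M` — THEOREM L (ii) at `M`**: every EVEN sign pattern on every CM type of `ℚ(ζ_M)` is the
  pattern of a unit of `𝓞 K` fixed by `ρ` (so `Sig(E⁺)` = the even hyperplane exactly, by part 67's THEOREM L (i)
  `norm_realUnits_pos_fifteen/_twenty/_twentyFour`);
* **the rows** (for every CM type `Φ` balanced for the displayed `N_K = {t : χ_K(t) = −1}`, i.e. of `K`-signature
  `(2,2)` — part 28): at `15`, **`not_exists_principal_fifteen_sqrt_neg_fifteen`** and **`…_fifteen_sqrt_neg_three`**
  (`n₋ = 1`, odd; `hN` discharged by part 67): the principal CM torus `ℂ^Φ/Φ(ℤ[ζ₁₅])` carries NO `ι`-compatible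
  principal polarisation; at `20` and `24`, **`exists_principal_twenty_sqrt_neg_one/_neg_five`**,
  **`exists_principal_twentyFour_sqrt_neg_one/_neg_two/_neg_three/_neg_six`** (`n₋ ∈ {0, 2}`): it CARRIES one.
  Since `h(ℚ(ζ_M)) = 1` at these levels, `ℂ^Φ/Φ(ℤ[ζ_M])` is, up to isomorphism, THE abelian fourfold with
  multiplication by `ℤ[ζ_M]` of type `Φ` (docstring-level, as in b01.23 (A)).

WHICH FOURFOLDS THESE ARE (COR-CM tree facts, cited not re-proved: `CorCM.CyclotomicRank.isNondegenerate_iff_isSimple_…`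
with `Pohlmann1968.not_isNondegenerate_of_fibres_balanced`): a `K`-balanced type of an octic cyclotomic field is
never primitive — the Weil-type cyclotomic CM fourfolds are NON-simple (part 77 states this as a theorem).

HONEST FRAMING: statements about Shimura's divisors `X_ζ′` of PRINCIPAL type on the principal CM torus
`ℂ^Φ/Φ(ℤ[ζ_M])` and about units of `𝓞 K`; witness tables checked by `decide +kernel`; the sets `N_K` are displayed
finite sets of residues (`χ_K(t) = −1` is docstring-level, as in parts 9/10/12/15); nothing here is a statement about
Hodge classes, `W_K`, general members or HC; `HC_CM` is used nowhere.  No `def`, no named fact, no `sorry`.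

References: [cite: Shimura1998, §14.3 Prop. 4–5, pp. 103–104]; [cite: Washington1997, §8.1]; census b01.23/28/44.
-/

noncomputable section

open Polynomial NumberField Complex Finset
open scoped Real nonZeroDivisors

namespace Summit.HodgeConjecture.Ring2WeilCoverage.CyclotomicSignaturesG4

open Literature.AlgebraicGeometry.Motives (CMType)
open Literature.AlgebraicGeometry.HodgeTheory (IsCMTypeSet)
open Literature.NumberTheory.ComplexMultiplication
open Summit.HodgeConjecture.Ring2WeilCoverage.CyclotomicUnitSignatures
open Summit.HodgeConjecture.Ring2WeilCoverage.CyclotomicPrincipalObstruction (not_exists_principal_of_norm_pos_of_odd)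
open Summit.HodgeConjecture.Ring2WeilCoverage.RealUnitNormAllLevels

variable {K : Type} [Field K] [NumberField K] {ζ : K}

section Level15

/-- `𝐞(t) = exp(2πi t/n) ∈ ℂ` (`ZMod.toCircle`). -/
local notation3 (prettyPrint := false) "𝐞 " t:max => ((ZMod.toCircle t : Circle) : ℂ)

/-- the sign predicate of `u(x) = ζ^h(1 − ζ^a)(1 − ζ^b)`, `x = (a, b, h)`, at the unit residue `t` (part 13). -/
local notation3 (prettyPrint := false) "negAt " x:max t:max =>
  (15 < (x : ℕ × ℕ × ℕ).1 * ZMod.val t % (2 * 15) ↔ 15 < (x : ℕ × ℕ × ℕ).2.1 * ZMod.val t % (2 * 15))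

/-- the sign pattern of the signed product `(A, ε)` at `t` (part 14). -/
local notation3 (prettyPrint := false) "pat " A:max ε:max t:max =>
  Odd ((Finset.filter (fun x : ℕ × ℕ × ℕ => negAt x t) A).card + (if (ε : Bool) then 1 else 0))

/-- admissibility of a triple `x = (a, b, h)` (part 13). -/
local notation3 (prettyPrint := false) "Adm " x:max =>
  (¬ 15 ∣ (x : ℕ × ℕ × ℕ).1 ∧ ¬ 15 ∣ (x : ℕ × ℕ × ℕ).2.1 ∧
    (2 * (x : ℕ × ℕ × ℕ).2.2 + (x : ℕ × ℕ × ℕ).1 + (x : ℕ × ℕ × ℕ).2.1) % (2 * 15) = 0 ∧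
    ¬ IsPrimePow (15 / Nat.gcd 15 (x : ℕ × ℕ × ℕ).1) ∧ ¬ IsPrimePow (15 / Nat.gcd 15 (x : ℕ × ℕ × ℕ).2.1))

/-! ### Level `15` (`g = 4`, `ℚ(ζ₁₅) = ℚ(ζ₃, ζ₅)`; generators `(a,b,h)` = (1,7,11), (1,11,9), (1,13,8)) -/

/-- **Witness table at level 15** (`decide`): for every unit residue `s ∉ {1, −1}` mod `15` ONE admissible unit
`ζ^h(1 − ζ)(1 − ζ^b)` is negative exactly at the places `{±1, ±s}`.
research route conditional on HC_CM; not a corollary; Q11.4-sentence-2 already refuted in dim ≥ 3. [folklore] -/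
theorem witnessTable_fifteen :
    ∀ s ∈ (Finset.univ.filter fun s : ZMod 15 => s.val.Coprime 15 ∧ s ≠ 1 ∧ s ≠ -1),
      ∃ w ∈ ({
    (2, {(1, 7, 11)}, false),
    (4, {(1, 11, 9)}, false),
    (7, {(1, 13, 8)}, false),
    (8, {(1, 13, 8)}, false),
    (11, {(1, 11, 9)}, false),
    (13, {(1, 7, 11)}, false)} :
      Finset (ZMod 15 × Finset (ℕ × ℕ × ℕ) × Bool)),
        w.1 = s ∧ (∀ x ∈ w.2.1, Adm x) ∧
          ∀ t ∈ (Finset.univ.filter fun t : ZMod 15 => t.val.Coprime 15),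
            (pat w.2.1 w.2.2 t ↔ (t = 1 ∨ t = -1 ∨ t = s ∨ t = -s)) := by
  decide +kernel

/-- **The witness property `(W)` of part 14 holds at level 15.**
research route conditional on HC_CM; not a corollary; Q11.4-sentence-2 already refuted in dim ≥ 3. [folklore] -/
theorem witnessProperty_fifteen :
    ∀ s : ZMod 15, s.val.Coprime 15 → s ≠ 1 → s ≠ -1 →
      ∃ A : Finset (ℕ × ℕ × ℕ), ∃ ε : Bool, (∀ x ∈ A, Adm x) ∧
        ∀ t : ZMod 15, t.val.Coprime 15 → (pat A ε t ↔ (t = 1 ∨ t = -1 ∨ t = s ∨ t = -s)) := by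
  intro s hs h1 h2
  obtain ⟨w, -, rfl, hA, hP⟩ :=
    witnessTable_fifteen s (Finset.mem_filter.mpr ⟨Finset.mem_univ _, hs, h1, h2⟩)
  exact ⟨w.2.1, w.2.2, hA, fun t ht => hP t (Finset.mem_filter.mpr ⟨Finset.mem_univ _, ht⟩)⟩

open scoped Classical in
/-- **THEOREM L (ii) AT LEVEL 15 — every even sign pattern on a CM type of `ℚ(ζ₁₅)` is a real unit's**: for any
`K` with `IsCyclotomicExtension {15} ℚ K`, `[IsCMField K]`, every CM type `Φ` and every `S ⊆ Φ` with `|S|` even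
there is a unit of `𝓞 K` fixed by `ρ`, negative (under `φ`) exactly for `φ ∈ S` (with part 67's
`norm_realUnits_pos_fifteen` — no odd pattern — `Sig(ℚ(ζ₁₅)⁺)` IS the even hyperplane).
research route conditional on HC_CM; not a corollary; Q11.4-sentence-2 already refuted in dim ≥ 3. [cite: Washington1997, §8.1] -/
theorem exists_units_sign_eq_fifteen [IsCMField K] [IsCyclotomicExtension {15} ℚ K] (hζ : IsPrimitiveRoot ζ 15)
    (Φ : CMType K) (S : Set (K →+* ℂ)) (hS : S ⊆ Φ.1) (hev : Even S.ncard) :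
    ∃ u : (𝓞 K)ˣ, IsCMField.complexConj K ((u : 𝓞 K) : K) = ((u : 𝓞 K) : K) ∧
      ∀ φ ∈ Φ.1, ((φ ((u : 𝓞 K) : K)).re < 0 ↔ φ ∈ S) :=
  exists_units_sign_eq hζ witnessProperty_fifteen Φ S hS hev

open scoped Classical in
/-- **CENSUS ROW `(ℚ(ζ₁₅), ℚ(√−15))` — NO, hypothesis-free**: for any `K` with `IsCyclotomicExtension {15} ℚ K`,
`[IsCMField K]`, and any CM type `Φ` balanced for `N_K = {7, 11, 13, 14}` (the unit residues `t` with
`χ_K(t) = −1`, `K = ℚ(√−15)`; `K`-signature `(2,2)`; `n₋ = 1` is odd), the principal CM torus `ℂ^Φ/Φ(ℤ[ζ₁₅])`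
carries NO `ι`-compatible principal polarisation:
`¬ ∃ ζ′, ζ′^ρ = −ζ′ ∧ (∀ φ ∈ Φ, Im φ(ζ′) > 0) ∧ CMTypeLattice.IsOfType 1 ζ′ ⊤` (part 7's obstruction; THEOREM
L (i) at `15` is part 67's `norm_realUnits_pos_fifteen`).
research route conditional on HC_CM; not a corollary; Q11.4-sentence-2 already refuted in dim ≥ 3. [cite: Shimura1998, §14.3 Prop. 5, p. 104] -/
theorem not_exists_principal_fifteen_sqrt_neg_fifteen [IsCMField K] [IsCyclotomicExtension {15} ℚ K]
    (hζ : IsPrimitiveRoot ζ 15) (Φ : CMType K)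
    (hbal : 2 * ((Finset.univ.filter fun t : ZMod 15 => ∃ σ ∈ Φ.1, σ ζ = 𝐞 t) ∩
        ({7, 11, 13, 14} : Finset (ZMod 15))).card =
      (Finset.univ.filter fun t : ZMod 15 => ∃ σ ∈ Φ.1, σ ζ = 𝐞 t).card) :
    ¬ ∃ ζ' : K, IsCMField.complexConj K ζ' = -ζ' ∧ (∀ φ : Φ.1, 0 < (φ.1 ζ').im) ∧
        CMTypeLattice.IsOfType (1 : (FractionalIdeal (𝓞 K)⁰ K)ˣ) ζ' ⊤ := by
  have hK : IsCMTypeSet 15 ({7, 11, 13, 14} : Finset (ZMod 15)) := by decide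
  have hg : Nat.totient 15 = 2 * (3 + 1) := by decide
  have hodd : Odd (({7, 11, 13, 14} : Finset (ZMod 15)).filter fun t : ZMod 15 => 2 * t.val < 15).card := by
    decide
  exact not_exists_principal_of_norm_pos_of_odd hζ hg Φ hK hbal hodd (norm_realUnits_pos_fifteen hζ)

open scoped Classical in
/-- **CENSUS ROW `(ℚ(ζ₁₅), ℚ(√−3))` — NO, hypothesis-free**: for any CM type `Φ` of `ℚ(ζ₁₅)` balanced for
`N_K = {2, 8, 11, 14}` (`χ_K(t) = −1 ⟺ t ≡ 2 (mod 3)`, `K = ℚ(√−3)`; `n₋ = 1` is odd), the principal CM torus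
`ℂ^Φ/Φ(ℤ[ζ₁₅])` carries NO `ι`-compatible principal polarisation.
research route conditional on HC_CM; not a corollary; Q11.4-sentence-2 already refuted in dim ≥ 3. [cite: Shimura1998, §14.3 Prop. 5, p. 104] -/
theorem not_exists_principal_fifteen_sqrt_neg_three [IsCMField K] [IsCyclotomicExtension {15} ℚ K]
    (hζ : IsPrimitiveRoot ζ 15) (Φ : CMType K)
    (hbal : 2 * ((Finset.univ.filter fun t : ZMod 15 => ∃ σ ∈ Φ.1, σ ζ = 𝐞 t) ∩
        ({2, 8, 11, 14} : Finset (ZMod 15))).card =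
      (Finset.univ.filter fun t : ZMod 15 => ∃ σ ∈ Φ.1, σ ζ = 𝐞 t).card) :
    ¬ ∃ ζ' : K, IsCMField.complexConj K ζ' = -ζ' ∧ (∀ φ : Φ.1, 0 < (φ.1 ζ').im) ∧
        CMTypeLattice.IsOfType (1 : (FractionalIdeal (𝓞 K)⁰ K)ˣ) ζ' ⊤ := by
  have hK : IsCMTypeSet 15 ({2, 8, 11, 14} : Finset (ZMod 15)) := by decide
  have hg : Nat.totient 15 = 2 * (3 + 1) := by decide
  have hodd : Odd (({2, 8, 11, 14} : Finset (ZMod 15)).filter fun t : ZMod 15 => 2 * t.val < 15).card := by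
    decide
  exact not_exists_principal_of_norm_pos_of_odd hζ hg Φ hK hbal hodd (norm_realUnits_pos_fifteen hζ)

end Level15

section Level20

/-- `𝐞(t) = exp(2πi t/n) ∈ ℂ` (`ZMod.toCircle`). -/
local notation3 (prettyPrint := false) "𝐞 " t:max => ((ZMod.toCircle t : Circle) : ℂ)

/-- the sign predicate of `u(x) = ζ^h(1 − ζ^a)(1 − ζ^b)`, `x = (a, b, h)`, at the unit residue `t` (part 13). -/
local notation3 (prettyPrint := false) "negAt " x:max t:max =>
  (20 < (x : ℕ × ℕ × ℕ).1 * ZMod.val t % (2 * 20) ↔ 20 < (x : ℕ × ℕ × ℕ).2.1 * ZMod.val t % (2 * 20))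

/-- the sign pattern of the signed product `(A, ε)` at `t` (part 14). -/
local notation3 (prettyPrint := false) "pat " A:max ε:max t:max =>
  Odd ((Finset.filter (fun x : ℕ × ℕ × ℕ => negAt x t) A).card + (if (ε : Bool) then 1 else 0))

/-- admissibility of a triple `x = (a, b, h)` (part 13). -/
local notation3 (prettyPrint := false) "Adm " x:max =>
  (¬ 20 ∣ (x : ℕ × ℕ × ℕ).1 ∧ ¬ 20 ∣ (x : ℕ × ℕ × ℕ).2.1 ∧
    (2 * (x : ℕ × ℕ × ℕ).2.2 + (x : ℕ × ℕ × ℕ).1 + (x : ℕ × ℕ × ℕ).2.1) % (2 * 20) = 0 ∧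
    ¬ IsPrimePow (20 / Nat.gcd 20 (x : ℕ × ℕ × ℕ).1) ∧ ¬ IsPrimePow (20 / Nat.gcd 20 (x : ℕ × ℕ × ℕ).2.1))

/-! ### Level `20` (`g = 4`, `ℚ(ζ₂₀) = ℚ(i, ζ₅)`; generators `(a,b,h)` = (1,3,18), (1,7,16), (1,9,15)) -/

/-- **Witness table at level 20** (`decide`): for every unit residue `s ∉ {1, −1}` mod `20` ONE admissible unit
`ζ^h(1 − ζ)(1 − ζ^b)` is negative exactly at the places `{±1, ±s}`.
research route conditional on HC_CM; not a corollary; Q11.4-sentence-2 already refuted in dim ≥ 3. [folklore] -/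
theorem witnessTable_twenty :
    ∀ s ∈ (Finset.univ.filter fun s : ZMod 20 => s.val.Coprime 20 ∧ s ≠ 1 ∧ s ≠ -1),
      ∃ w ∈ ({
    (3, {(1, 3, 18)}, false),
    (7, {(1, 7, 16)}, false),
    (9, {(1, 9, 15)}, false),
    (11, {(1, 9, 15)}, false),
    (13, {(1, 7, 16)}, false),
    (17, {(1, 3, 18)}, false)} :
      Finset (ZMod 20 × Finset (ℕ × ℕ × ℕ) × Bool)),
        w.1 = s ∧ (∀ x ∈ w.2.1, Adm x) ∧
          ∀ t ∈ (Finset.univ.filter fun t : ZMod 20 => t.val.Coprime 20),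
            (pat w.2.1 w.2.2 t ↔ (t = 1 ∨ t = -1 ∨ t = s ∨ t = -s)) := by
  decide +kernel

/-- **The witness property `(W)` of part 14 holds at level 20.**
research route conditional on HC_CM; not a corollary; Q11.4-sentence-2 already refuted in dim ≥ 3. [folklore] -/
theorem witnessProperty_twenty :
    ∀ s : ZMod 20, s.val.Coprime 20 → s ≠ 1 → s ≠ -1 →
      ∃ A : Finset (ℕ × ℕ × ℕ), ∃ ε : Bool, (∀ x ∈ A, Adm x) ∧
        ∀ t : ZMod 20, t.val.Coprime 20 → (pat A ε t ↔ (t = 1 ∨ t = -1 ∨ t = s ∨ t = -s)) := by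
  intro s hs h1 h2
  obtain ⟨w, -, rfl, hA, hP⟩ :=
    witnessTable_twenty s (Finset.mem_filter.mpr ⟨Finset.mem_univ _, hs, h1, h2⟩)
  exact ⟨w.2.1, w.2.2, hA, fun t ht => hP t (Finset.mem_filter.mpr ⟨Finset.mem_univ _, ht⟩)⟩

open scoped Classical in
/-- **THEOREM L (ii) AT LEVEL 20 — every even sign pattern on a CM type of `ℚ(ζ₂₀)` is a real unit's** (and, with
part 67's `norm_realUnits_pos_twenty`, `Sig(ℚ(ζ₂₀)⁺)` is exactly the even hyperplane).
research route conditional on HC_CM; not a corollary; Q11.4-sentence-2 already refuted in dim ≥ 3. [cite: Washington1997, §8.1] -/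
theorem exists_units_sign_eq_twenty [IsCMField K] [IsCyclotomicExtension {20} ℚ K] (hζ : IsPrimitiveRoot ζ 20)
    (Φ : CMType K) (S : Set (K →+* ℂ)) (hS : S ⊆ Φ.1) (hev : Even S.ncard) :
    ∃ u : (𝓞 K)ˣ, IsCMField.complexConj K ((u : 𝓞 K) : K) = ((u : 𝓞 K) : K) ∧
      ∀ φ ∈ Φ.1, ((φ ((u : 𝓞 K) : K)).re < 0 ↔ φ ∈ S) :=
  exists_units_sign_eq hζ witnessProperty_twenty Φ S hS hev

open scoped Classical in
/-- **CENSUS ROW `(ℚ(ζ₂₀), ℚ(i))` — UNCONDITIONAL YES: the principal CM torus `ℂ^Φ/Φ(ℤ[ζ₂₀])` CARRIES an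
`ι`-compatible principal polarisation** for every CM type `Φ` of `ℚ(ζ₂₀)` balanced for `N_K = {3, 7, 11, 19}` (the
unit residues `t ≡ 3 (mod 4)`, `χ_K(t) = −1`, `K = ℚ(i)`; `n₋ = 2` is even):
`∃ ζ′, ζ′^ρ = −ζ′ ∧ (∀ φ ∈ Φ, Im φ(ζ′) > 0) ∧ CMTypeLattice.IsOfType 1 ζ′ ⊤` (parts 7/13/14 + the table).
research route conditional on HC_CM; not a corollary; Q11.4-sentence-2 already refuted in dim ≥ 3. [cite: Shimura1998, §14.3 Prop. 5, p. 104] -/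
theorem exists_principal_twenty_sqrt_neg_one [IsCMField K] [IsCyclotomicExtension {20} ℚ K]
    (hζ : IsPrimitiveRoot ζ 20) (Φ : CMType K)
    (hbal : 2 * ((Finset.univ.filter fun t : ZMod 20 => ∃ σ ∈ Φ.1, σ ζ = 𝐞 t) ∩
        ({3, 7, 11, 19} : Finset (ZMod 20))).card =
      (Finset.univ.filter fun t : ZMod 20 => ∃ σ ∈ Φ.1, σ ζ = 𝐞 t).card) :
    ∃ ζ' : K, IsCMField.complexConj K ζ' = -ζ' ∧ (∀ φ : Φ.1, 0 < (φ.1 ζ').im) ∧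
        CMTypeLattice.IsOfType (1 : (FractionalIdeal (𝓞 K)⁰ K)ˣ) ζ' ⊤ := by
  have hg : Nat.totient 20 = 2 * (3 + 1) := by decide
  have hNK : IsCMTypeSet 20 ({3, 7, 11, 19} : Finset (ZMod 20)) := by decide
  have heven : Even (({3, 7, 11, 19} : Finset (ZMod 20)).filter fun t : ZMod 20 => 2 * t.val < 20).card := by
    decide
  exact exists_principal_of_witnesses hζ hg witnessProperty_twenty Φ hNK hbal heven

open scoped Classical in
/-- **CENSUS ROW `(ℚ(ζ₂₀), ℚ(√−5))` — UNCONDITIONAL YES: the principal CM torus `ℂ^Φ/Φ(ℤ[ζ₂₀])` CARRIES an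
`ι`-compatible principal polarisation** for every CM type `Φ` of `ℚ(ζ₂₀)` balanced for `N_K = {11, 13, 17, 19}`
(`χ_K = χ₋₄·χ₅`, `K = ℚ(√−5)`; `n₋ = 0` is even).
research route conditional on HC_CM; not a corollary; Q11.4-sentence-2 already refuted in dim ≥ 3. [cite: Shimura1998, §14.3 Prop. 5, p. 104] -/
theorem exists_principal_twenty_sqrt_neg_five [IsCMField K] [IsCyclotomicExtension {20} ℚ K]
    (hζ : IsPrimitiveRoot ζ 20) (Φ : CMType K)
    (hbal : 2 * ((Finset.univ.filter fun t : ZMod 20 => ∃ σ ∈ Φ.1, σ ζ = 𝐞 t) ∩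
        ({11, 13, 17, 19} : Finset (ZMod 20))).card =
      (Finset.univ.filter fun t : ZMod 20 => ∃ σ ∈ Φ.1, σ ζ = 𝐞 t).card) :
    ∃ ζ' : K, IsCMField.complexConj K ζ' = -ζ' ∧ (∀ φ : Φ.1, 0 < (φ.1 ζ').im) ∧
        CMTypeLattice.IsOfType (1 : (FractionalIdeal (𝓞 K)⁰ K)ˣ) ζ' ⊤ := by
  have hg : Nat.totient 20 = 2 * (3 + 1) := by decide
  have hNK : IsCMTypeSet 20 ({11, 13, 17, 19} : Finset (ZMod 20)) := by decide
  have heven : Even (({11, 13, 17, 19} : Finset (ZMod 20)).filter fun t : ZMod 20 => 2 * t.val < 20).card := by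
    decide
  exact exists_principal_of_witnesses hζ hg witnessProperty_twenty Φ hNK hbal heven

end Level20

section Level24

/-- `𝐞(t) = exp(2πi t/n) ∈ ℂ` (`ZMod.toCircle`). -/
local notation3 (prettyPrint := false) "𝐞 " t:max => ((ZMod.toCircle t : Circle) : ℂ)

/-- the sign predicate of `u(x) = ζ^h(1 − ζ^a)(1 − ζ^b)`, `x = (a, b, h)`, at the unit residue `t` (part 13). -/
local notation3 (prettyPrint := false) "negAt " x:max t:max =>
  (24 < (x : ℕ × ℕ × ℕ).1 * ZMod.val t % (2 * 24) ↔ 24 < (x : ℕ × ℕ × ℕ).2.1 * ZMod.val t % (2 * 24))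

/-- the sign pattern of the signed product `(A, ε)` at `t` (part 14). -/
local notation3 (prettyPrint := false) "pat " A:max ε:max t:max =>
  Odd ((Finset.filter (fun x : ℕ × ℕ × ℕ => negAt x t) A).card + (if (ε : Bool) then 1 else 0))

/-- admissibility of a triple `x = (a, b, h)` (part 13). -/
local notation3 (prettyPrint := false) "Adm " x:max =>
  (¬ 24 ∣ (x : ℕ × ℕ × ℕ).1 ∧ ¬ 24 ∣ (x : ℕ × ℕ × ℕ).2.1 ∧
    (2 * (x : ℕ × ℕ × ℕ).2.2 + (x : ℕ × ℕ × ℕ).1 + (x : ℕ × ℕ × ℕ).2.1) % (2 * 24) = 0 ∧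
    ¬ IsPrimePow (24 / Nat.gcd 24 (x : ℕ × ℕ × ℕ).1) ∧ ¬ IsPrimePow (24 / Nat.gcd 24 (x : ℕ × ℕ × ℕ).2.1))

/-! ### Level `24` (`g = 4`, `ℚ(ζ₂₄) = ℚ(i, √2, √−3)`; generators `(a,b,h)` = (1,5,21), (1,7,20), (1,11,18)) -/

/-- **Witness table at level 24** (`decide`): for every unit residue `s ∉ {1, −1}` mod `24` ONE admissible unit
`ζ^h(1 − ζ)(1 − ζ^b)` is negative exactly at the places `{±1, ±s}`.
research route conditional on HC_CM; not a corollary; Q11.4-sentence-2 already refuted in dim ≥ 3. [folklore] -/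
theorem witnessTable_twentyFour :
    ∀ s ∈ (Finset.univ.filter fun s : ZMod 24 => s.val.Coprime 24 ∧ s ≠ 1 ∧ s ≠ -1),
      ∃ w ∈ ({
    (5, {(1, 11, 18)}, false),
    (7, {(1, 7, 20)}, false),
    (11, {(1, 5, 21)}, false),
    (13, {(1, 5, 21)}, false),
    (17, {(1, 7, 20)}, false),
    (19, {(1, 11, 18)}, false)} :
      Finset (ZMod 24 × Finset (ℕ × ℕ × ℕ) × Bool)),
        w.1 = s ∧ (∀ x ∈ w.2.1, Adm x) ∧
          ∀ t ∈ (Finset.univ.filter fun t : ZMod 24 => t.val.Coprime 24),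
            (pat w.2.1 w.2.2 t ↔ (t = 1 ∨ t = -1 ∨ t = s ∨ t = -s)) := by
  decide +kernel

/-- **The witness property `(W)` of part 14 holds at level 24.**
research route conditional on HC_CM; not a corollary; Q11.4-sentence-2 already refuted in dim ≥ 3. [folklore] -/
theorem witnessProperty_twentyFour :
    ∀ s : ZMod 24, s.val.Coprime 24 → s ≠ 1 → s ≠ -1 →
      ∃ A : Finset (ℕ × ℕ × ℕ), ∃ ε : Bool, (∀ x ∈ A, Adm x) ∧
        ∀ t : ZMod 24, t.val.Coprime 24 → (pat A ε t ↔ (t = 1 ∨ t = -1 ∨ t = s ∨ t = -s)) := by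
  intro s hs h1 h2
  obtain ⟨w, -, rfl, hA, hP⟩ :=
    witnessTable_twentyFour s (Finset.mem_filter.mpr ⟨Finset.mem_univ _, hs, h1, h2⟩)
  exact ⟨w.2.1, w.2.2, hA, fun t ht => hP t (Finset.mem_filter.mpr ⟨Finset.mem_univ _, ht⟩)⟩

open scoped Classical in
/-- **THEOREM L (ii) AT LEVEL 24 — every even sign pattern on a CM type of `ℚ(ζ₂₄)` is a real unit's**
(`ℚ(ζ₂₄)⁺ = ℚ(√2, √3)`: the three units `ζ^h(1 − ζ)(1 − ζ^b)` of the table are negative at exactly two of the four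
real places; with part 67's `norm_realUnits_pos_twentyFour`, `Sig(ℚ(√2, √3))` is exactly the even hyperplane).
research route conditional on HC_CM; not a corollary; Q11.4-sentence-2 already refuted in dim ≥ 3. [cite: Washington1997, §8.1] -/
theorem exists_units_sign_eq_twentyFour [IsCMField K] [IsCyclotomicExtension {24} ℚ K] (hζ : IsPrimitiveRoot ζ 24)
    (Φ : CMType K) (S : Set (K →+* ℂ)) (hS : S ⊆ Φ.1) (hev : Even S.ncard) :
    ∃ u : (𝓞 K)ˣ, IsCMField.complexConj K ((u : 𝓞 K) : K) = ((u : 𝓞 K) : K) ∧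
      ∀ φ ∈ Φ.1, ((φ ((u : 𝓞 K) : K)).re < 0 ↔ φ ∈ S) :=
  exists_units_sign_eq hζ witnessProperty_twentyFour Φ S hS hev

open scoped Classical in
/-- **CENSUS ROW `(ℚ(ζ₂₄), ℚ(i))` — UNCONDITIONAL YES: the principal CM torus `ℂ^Φ/Φ(ℤ[ζ₂₄])` CARRIES an
`ι`-compatible principal polarisation** for every CM type `Φ` of `ℚ(ζ₂₄)` balanced for `N_K = {7, 11, 19, 23}`
(`t ≡ 3 (mod 4)`, `K = ℚ(i)`; `n₋ = 2` is even).
research route conditional on HC_CM; not a corollary; Q11.4-sentence-2 already refuted in dim ≥ 3. [cite: Shimura1998, §14.3 Prop. 5, p. 104] -/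
theorem exists_principal_twentyFour_sqrt_neg_one [IsCMField K] [IsCyclotomicExtension {24} ℚ K]
    (hζ : IsPrimitiveRoot ζ 24) (Φ : CMType K)
    (hbal : 2 * ((Finset.univ.filter fun t : ZMod 24 => ∃ σ ∈ Φ.1, σ ζ = 𝐞 t) ∩
        ({7, 11, 19, 23} : Finset (ZMod 24))).card =
      (Finset.univ.filter fun t : ZMod 24 => ∃ σ ∈ Φ.1, σ ζ = 𝐞 t).card) :
    ∃ ζ' : K, IsCMField.complexConj K ζ' = -ζ' ∧ (∀ φ : Φ.1, 0 < (φ.1 ζ').im) ∧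
        CMTypeLattice.IsOfType (1 : (FractionalIdeal (𝓞 K)⁰ K)ˣ) ζ' ⊤ := by
  have hg : Nat.totient 24 = 2 * (3 + 1) := by decide
  have hNK : IsCMTypeSet 24 ({7, 11, 19, 23} : Finset (ZMod 24)) := by decide
  have heven : Even (({7, 11, 19, 23} : Finset (ZMod 24)).filter fun t : ZMod 24 => 2 * t.val < 24).card := by
    decide
  exact exists_principal_of_witnesses hζ hg witnessProperty_twentyFour Φ hNK hbal heven

open scoped Classical in
/-- **CENSUS ROW `(ℚ(ζ₂₄), ℚ(√−2))` — UNCONDITIONAL YES** for every CM type `Φ` of `ℚ(ζ₂₄)` balanced for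
`N_K = {5, 7, 13, 23}` (`t ≡ 5, 7 (mod 8)`, `K = ℚ(√−2)`; `n₋ = 2` is even).
research route conditional on HC_CM; not a corollary; Q11.4-sentence-2 already refuted in dim ≥ 3. [cite: Shimura1998, §14.3 Prop. 5, p. 104] -/
theorem exists_principal_twentyFour_sqrt_neg_two [IsCMField K] [IsCyclotomicExtension {24} ℚ K]
    (hζ : IsPrimitiveRoot ζ 24) (Φ : CMType K)
    (hbal : 2 * ((Finset.univ.filter fun t : ZMod 24 => ∃ σ ∈ Φ.1, σ ζ = 𝐞 t) ∩
        ({5, 7, 13, 23} : Finset (ZMod 24))).card =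
      (Finset.univ.filter fun t : ZMod 24 => ∃ σ ∈ Φ.1, σ ζ = 𝐞 t).card) :
    ∃ ζ' : K, IsCMField.complexConj K ζ' = -ζ' ∧ (∀ φ : Φ.1, 0 < (φ.1 ζ').im) ∧
        CMTypeLattice.IsOfType (1 : (FractionalIdeal (𝓞 K)⁰ K)ˣ) ζ' ⊤ := by
  have hg : Nat.totient 24 = 2 * (3 + 1) := by decide
  have hNK : IsCMTypeSet 24 ({5, 7, 13, 23} : Finset (ZMod 24)) := by decide
  have heven : Even (({5, 7, 13, 23} : Finset (ZMod 24)).filter fun t : ZMod 24 => 2 * t.val < 24).card := by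
    decide
  exact exists_principal_of_witnesses hζ hg witnessProperty_twentyFour Φ hNK hbal heven

open scoped Classical in
/-- **CENSUS ROW `(ℚ(ζ₂₄), ℚ(√−3))` — UNCONDITIONAL YES** for every CM type `Φ` of `ℚ(ζ₂₄)` balanced for
`N_K = {5, 11, 17, 23}` (`t ≡ 2 (mod 3)`, `K = ℚ(√−3)`; `n₋ = 2` is even).
research route conditional on HC_CM; not a corollary; Q11.4-sentence-2 already refuted in dim ≥ 3. [cite: Shimura1998, §14.3 Prop. 5, p. 104] -/
theorem exists_principal_twentyFour_sqrt_neg_three [IsCMField K] [IsCyclotomicExtension {24} ℚ K]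
    (hζ : IsPrimitiveRoot ζ 24) (Φ : CMType K)
    (hbal : 2 * ((Finset.univ.filter fun t : ZMod 24 => ∃ σ ∈ Φ.1, σ ζ = 𝐞 t) ∩
        ({5, 11, 17, 23} : Finset (ZMod 24))).card =
      (Finset.univ.filter fun t : ZMod 24 => ∃ σ ∈ Φ.1, σ ζ = 𝐞 t).card) :
    ∃ ζ' : K, IsCMField.complexConj K ζ' = -ζ' ∧ (∀ φ : Φ.1, 0 < (φ.1 ζ').im) ∧
        CMTypeLattice.IsOfType (1 : (FractionalIdeal (𝓞 K)⁰ K)ˣ) ζ' ⊤ := by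
  have hg : Nat.totient 24 = 2 * (3 + 1) := by decide
  have hNK : IsCMTypeSet 24 ({5, 11, 17, 23} : Finset (ZMod 24)) := by decide
  have heven : Even (({5, 11, 17, 23} : Finset (ZMod 24)).filter fun t : ZMod 24 => 2 * t.val < 24).card := by
    decide
  exact exists_principal_of_witnesses hζ hg witnessProperty_twentyFour Φ hNK hbal heven

open scoped Classical in
/-- **CENSUS ROW `(ℚ(ζ₂₄), ℚ(√−6))` — UNCONDITIONAL YES** for every CM type `Φ` of `ℚ(ζ₂₄)` balanced for
`N_K = {13, 17, 19, 23}` (`χ_K = χ₋₈·χ₁₂`, `K = ℚ(√−6)`; `n₋ = 0` is even).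
research route conditional on HC_CM; not a corollary; Q11.4-sentence-2 already refuted in dim ≥ 3. [cite: Shimura1998, §14.3 Prop. 5, p. 104] -/
theorem exists_principal_twentyFour_sqrt_neg_six [IsCMField K] [IsCyclotomicExtension {24} ℚ K]
    (hζ : IsPrimitiveRoot ζ 24) (Φ : CMType K)
    (hbal : 2 * ((Finset.univ.filter fun t : ZMod 24 => ∃ σ ∈ Φ.1, σ ζ = 𝐞 t) ∩
        ({13, 17, 19, 23} : Finset (ZMod 24))).card =
      (Finset.univ.filter fun t : ZMod 24 => ∃ σ ∈ Φ.1, σ ζ = 𝐞 t).card) :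
    ∃ ζ' : K, IsCMField.complexConj K ζ' = -ζ' ∧ (∀ φ : Φ.1, 0 < (φ.1 ζ').im) ∧
        CMTypeLattice.IsOfType (1 : (FractionalIdeal (𝓞 K)⁰ K)ˣ) ζ' ⊤ := by
  have hg : Nat.totient 24 = 2 * (3 + 1) := by decide
  have hNK : IsCMTypeSet 24 ({13, 17, 19, 23} : Finset (ZMod 24)) := by decide
  have heven : Even (({13, 17, 19, 23} : Finset (ZMod 24)).filter fun t : ZMod 24 => 2 * t.val < 24).card := by
    decide
  exact exists_principal_of_witnesses hζ hg witnessProperty_twentyFour Φ hNK hbal heven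

end Level24

end Summit.HodgeConjecture.Ring2WeilCoverage.CyclotomicSignaturesG4

end
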